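import Literature.Barriers.CriticalPhenomena.PlaquetteWalkFacePath
import Literature.Barriers.CriticalPhenomena.PlaquetteWalkHoleRootColumnLawBelow
import HarnessLib

/-!
# Barrier catalogue (SAWScalingLimit): the PARAMETRIC column witnesses — the COLUMN LAW at EVERY cell of the two quadrants east of the root column
(«QUADRANT LAW»)

`Z → ∞` limit model of the printed Yang–Baxter weights [GlazmanManolescu2019, §1, eq. (1)]; the «RECTANGLE COEFFICIENT» line of the venture lane «pcv-sawmu»
(b-engine-1 g27). `PlaquetteWalkHoleRootColumnLawWitness` decides the `E`-frame witness one cell at a time (`k ≤ 1`, `1 ≤ y ≤ 2`). Here the witness is written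
as a FACE PATH (`PlaquetteWalkFacePath.YBWalk.ofFacePath`) for ALL `k ≥ 0`, `y ≥ 1`: from the root `(4,2).side W` east along the root row to `(4+k, 2)`, turn
`W→N`, north up column `4+k` into `r = (4+k, 2+y)` (`S→W`, the turning first arc), west along row `2+y` to `(2, 2+y)` (`E→S`), south down column `2` past the
hole `(3,2)` to `(2,1)` (`N→E`), east along row `1` to `(6+k, 1)` (`W→N`), north up column `6+k` to `(6+k, 2+y)` (`S→W`), west into `r` through its `E` side:
`3k + 3y + 10` arcs in pairwise distinct faces, six of them turning (limit cost `7`), ONE exit mid-edge (`slant (6+k) 2`) on the eastern ray of the hole (odd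
ray count ⇒ wound), first hit `k + y`, no later arc in `r` (class `B2a`). With the transport of `PlaquetteWalkHoleRootColumnLawWitness` and the mirror of
`PlaquetteWalkHoleRootColumnLawBelow`: ★★★★★ `vertexFunctional_printed_exists_ne_zero_of_colFrame` / `…_of_colFrame_below` — for EVERY `k ≥ 0`, `y ≥ 1` and
every finite face list containing the frame `colFrame w k y` (resp. its reflection) and missing the hole, the printed vertex functional at `(w.1 + k, w.2 ± y)` is
not identically zero on `(0, π)`: the sufficiency half of the lane's (S5) for the quadrants. [GlazmanManolescu2019 §1 Fig. 1, eq. (1), §4.2, Lemma 2.1,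
Remark 2.2; Glazman2015WeightedSAW Lemma 3.1 (proof, pp. 6–7); CourantRobbins1958 Ch. V App. §2]
-/

noncomputable section

open Set Function Complex

namespace Literature.Barriers.CriticalPhenomena.PlaquetteWalk

open Literature.Probability.RandomPlanarGeometry.SAW.YangBaxter
open Real Complex

/-! ## §1 The face path of the column witness `(k, y)` at the reference root `(4,2)` -/

section Reference

variable (k y : ℕ)

/-- The faces of the column witness `(k, y)`, in order (`3k + 3y + 10` of them): root row `(4..4+k, 2)`, column `(4+k, 3..2+y)`, row `(3+k..2, 2+y)`, column
`(2, 1+y..1)`, row `(3..6+k, 1)`, column `(6+k, 2..2+y)`, and `(5+k, 2+y)`. [cite: GlazmanManolescu2019, §1 (definition of the model), Fig. 1] -/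
def colFace (i : ℕ) : Face :=
  if i ≤ k then ((4 : ℤ) + i, 2)
  else if i ≤ k + y then ((4 : ℤ) + k, (2 : ℤ) + i - k)
  else if i ≤ 2 * k + y + 2 then ((4 : ℤ) + 2 * k + y - i, (2 : ℤ) + y)
  else if i ≤ 2 * k + 2 * y + 3 then ((2 : ℤ), (4 : ℤ) + 2 * k + 2 * y - i)
  else if i ≤ 3 * k + 2 * y + 7 then ((i : ℤ) - 2 * k - 2 * y - 1, 1)
  else if i ≤ 3 * k + 3 * y + 8 then ((6 : ℤ) + k, (i : ℤ) - 3 * k - 2 * y - 6)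
  else ((5 : ℤ) + k, (2 : ℤ) + y)

/-- The entry sides of the column witness `(k, y)`. [cite: GlazmanManolescu2019, §1 (definition of the model), Fig. 2] -/
def colIn (i : ℕ) : Side :=
  if i ≤ k then .W
  else if i ≤ k + y then .S
  else if i ≤ 2 * k + y + 2 then .E
  else if i ≤ 2 * k + 2 * y + 3 then .N
  else if i ≤ 3 * k + 2 * y + 7 then .W
  else if i ≤ 3 * k + 3 * y + 8 then .S
  else .E

/-- The exit sides of the column witness `(k, y)` (each run ends with its turn). [cite: GlazmanManolescu2019, §1 (definition of the model), Fig. 2] -/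
def colOut (i : ℕ) : Side :=
  if i < k then .E
  else if i = k then .N
  else if i < k + y then .N
  else if i = k + y then .W
  else if i < 2 * k + y + 2 then .W
  else if i = 2 * k + y + 2 then .S
  else if i < 2 * k + 2 * y + 3 then .S
  else if i = 2 * k + 2 * y + 3 then .E
  else if i < 3 * k + 2 * y + 7 then .E
  else if i = 3 * k + 2 * y + 7 then .N
  else if i < 3 * k + 3 * y + 8 then .N
  else .W

/-- The reference frame of the column witness `(k, y)`: its faces, listed along the path. [cite: GlazmanManolescu2019, §2.1 (finite domains of faces)] -/
def colFrame42 : List Face := (List.range (3 * k + 3 * y + 10)).map (colFace k y)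

variable {k y}

/-! ### Piece lemmas (the `if`-chains evaluated on each run and corner) -/

/-- The faces on piece `A`. [cite: GlazmanManolescu2019, §1 (definition of the model)] -/
theorem colFace_A {i : ℕ} (h : i ≤ k) : colFace k y i = ((4 : ℤ) + i, 2) := by
  unfold colFace
  rw [if_pos (show i ≤ k by omega)]

/-- The entry sides on piece `A`. [cite: GlazmanManolescu2019, §1 (definition of the model)] -/
theorem colIn_A {i : ℕ} (h : i ≤ k) : colIn k y i = .W := by
  unfold colIn
  rw [if_pos (show i ≤ k by omega)]

/-- The faces on piece `B`. [cite: GlazmanManolescu2019, §1 (definition of the model)] -/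
theorem colFace_B {i : ℕ} (h1 : k < i) (h2 : i ≤ k + y) : colFace k y i = ((4 : ℤ) + k, (2 : ℤ) + i - k) := by
  unfold colFace
  rw [if_neg (show ¬(i ≤ k) by omega), if_pos (show i ≤ k + y by omega)]

/-- The entry sides on piece `B`. [cite: GlazmanManolescu2019, §1 (definition of the model)] -/
theorem colIn_B {i : ℕ} (h1 : k < i) (h2 : i ≤ k + y) : colIn k y i = .S := by
  unfold colIn
  rw [if_neg (show ¬(i ≤ k) by omega), if_pos (show i ≤ k + y by omega)]

/-- The faces on piece `C`. [cite: GlazmanManolescu2019, §1 (definition of the model)] -/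
theorem colFace_C {i : ℕ} (h1 : k + y < i) (h2 : i ≤ 2 * k + y + 2) : colFace k y i = ((4 : ℤ) + 2 * k + y - i, (2 : ℤ) + y) := by
  unfold colFace
  rw [if_neg (show ¬(i ≤ k) by omega), if_neg (show ¬(i ≤ k + y) by omega), if_pos (show i ≤ 2 * k + y + 2 by omega)]

/-- The entry sides on piece `C`. [cite: GlazmanManolescu2019, §1 (definition of the model)] -/
theorem colIn_C {i : ℕ} (h1 : k + y < i) (h2 : i ≤ 2 * k + y + 2) : colIn k y i = .E := by
  unfold colIn
  rw [if_neg (show ¬(i ≤ k) by omega), if_neg (show ¬(i ≤ k + y) by omega), if_pos (show i ≤ 2 * k + y + 2 by omega)]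

/-- The faces on piece `D`. [cite: GlazmanManolescu2019, §1 (definition of the model)] -/
theorem colFace_D {i : ℕ} (h1 : 2 * k + y + 2 < i) (h2 : i ≤ 2 * k + 2 * y + 3) : colFace k y i = ((2 : ℤ), (4 : ℤ) + 2 * k + 2 * y - i) := by
  unfold colFace
  rw [if_neg (show ¬(i ≤ k) by omega), if_neg (show ¬(i ≤ k + y) by omega), if_neg (show ¬(i ≤ 2 * k + y + 2) by omega), if_pos (show i ≤ 2 * k + 2 * y + 3 by omega)]

/-- The entry sides on piece `D`. [cite: GlazmanManolescu2019, §1 (definition of the model)] -/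
theorem colIn_D {i : ℕ} (h1 : 2 * k + y + 2 < i) (h2 : i ≤ 2 * k + 2 * y + 3) : colIn k y i = .N := by
  unfold colIn
  rw [if_neg (show ¬(i ≤ k) by omega), if_neg (show ¬(i ≤ k + y) by omega), if_neg (show ¬(i ≤ 2 * k + y + 2) by omega), if_pos (show i ≤ 2 * k + 2 * y + 3 by omega)]

/-- The faces on piece `E`. [cite: GlazmanManolescu2019, §1 (definition of the model)] -/
theorem colFace_E {i : ℕ} (h1 : 2 * k + 2 * y + 3 < i) (h2 : i ≤ 3 * k + 2 * y + 7) : colFace k y i = ((i : ℤ) - 2 * k - 2 * y - 1, 1) := by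
  unfold colFace
  rw [if_neg (show ¬(i ≤ k) by omega), if_neg (show ¬(i ≤ k + y) by omega), if_neg (show ¬(i ≤ 2 * k + y + 2) by omega), if_neg (show ¬(i ≤ 2 * k + 2 * y + 3) by omega), if_pos (show i ≤ 3 * k + 2 * y + 7 by omega)]

/-- The entry sides on piece `E`. [cite: GlazmanManolescu2019, §1 (definition of the model)] -/
theorem colIn_E {i : ℕ} (h1 : 2 * k + 2 * y + 3 < i) (h2 : i ≤ 3 * k + 2 * y + 7) : colIn k y i = .W := by
  unfold colIn
  rw [if_neg (show ¬(i ≤ k) by omega), if_neg (show ¬(i ≤ k + y) by omega), if_neg (show ¬(i ≤ 2 * k + y + 2) by omega), if_neg (show ¬(i ≤ 2 * k + 2 * y + 3) by omega), if_pos (show i ≤ 3 * k + 2 * y + 7 by omega)]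

/-- The faces on piece `F`. [cite: GlazmanManolescu2019, §1 (definition of the model)] -/
theorem colFace_F {i : ℕ} (h1 : 3 * k + 2 * y + 7 < i) (h2 : i ≤ 3 * k + 3 * y + 8) : colFace k y i = ((6 : ℤ) + k, (i : ℤ) - 3 * k - 2 * y - 6) := by
  unfold colFace
  rw [if_neg (show ¬(i ≤ k) by omega), if_neg (show ¬(i ≤ k + y) by omega), if_neg (show ¬(i ≤ 2 * k + y + 2) by omega), if_neg (show ¬(i ≤ 2 * k + 2 * y + 3) by omega), if_neg (show ¬(i ≤ 3 * k + 2 * y + 7) by omega), if_pos (show i ≤ 3 * k + 3 * y + 8 by omega)]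

/-- The entry sides on piece `F`. [cite: GlazmanManolescu2019, §1 (definition of the model)] -/
theorem colIn_F {i : ℕ} (h1 : 3 * k + 2 * y + 7 < i) (h2 : i ≤ 3 * k + 3 * y + 8) : colIn k y i = .S := by
  unfold colIn
  rw [if_neg (show ¬(i ≤ k) by omega), if_neg (show ¬(i ≤ k + y) by omega), if_neg (show ¬(i ≤ 2 * k + y + 2) by omega), if_neg (show ¬(i ≤ 2 * k + 2 * y + 3) by omega), if_neg (show ¬(i ≤ 3 * k + 2 * y + 7) by omega), if_pos (show i ≤ 3 * k + 3 * y + 8 by omega)]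

/-- The faces on piece `G`. [cite: GlazmanManolescu2019, §1 (definition of the model)] -/
theorem colFace_G {i : ℕ} (h1 : 3 * k + 3 * y + 8 < i) : colFace k y i = ((5 : ℤ) + k, (2 : ℤ) + y) := by
  unfold colFace
  rw [if_neg (show ¬(i ≤ k) by omega), if_neg (show ¬(i ≤ k + y) by omega), if_neg (show ¬(i ≤ 2 * k + y + 2) by omega), if_neg (show ¬(i ≤ 2 * k + 2 * y + 3) by omega), if_neg (show ¬(i ≤ 3 * k + 2 * y + 7) by omega), if_neg (show ¬(i ≤ 3 * k + 3 * y + 8) by omega)]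

/-- The entry sides on piece `G`. [cite: GlazmanManolescu2019, §1 (definition of the model)] -/
theorem colIn_G {i : ℕ} (h1 : 3 * k + 3 * y + 8 < i) : colIn k y i = .E := by
  unfold colIn
  rw [if_neg (show ¬(i ≤ k) by omega), if_neg (show ¬(i ≤ k + y) by omega), if_neg (show ¬(i ≤ 2 * k + y + 2) by omega), if_neg (show ¬(i ≤ 2 * k + 2 * y + 3) by omega), if_neg (show ¬(i ≤ 3 * k + 2 * y + 7) by omega), if_neg (show ¬(i ≤ 3 * k + 3 * y + 8) by omega)]

/-- The exit sides on piece `A0`. [cite: GlazmanManolescu2019, §1 (definition of the model)] -/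
theorem colOut_A0 {i : ℕ} (h : i < k) : colOut k y i = .E := by
  unfold colOut
  rw [if_pos (show i < k by omega)]

/-- The exit sides on piece `A1`. [cite: GlazmanManolescu2019, §1 (definition of the model)] -/
theorem colOut_A1 {i : ℕ} (h1 : k ≤ i) (h2 : i ≤ k) : colOut k y i = .N := by
  unfold colOut
  rw [if_neg (show ¬(i < k) by omega), if_pos (show i = k by omega)]

/-- The exit sides on piece `B0`. [cite: GlazmanManolescu2019, §1 (definition of the model)] -/
theorem colOut_B0 {i : ℕ} (h1 : k < i) (h2 : i < k + y) : colOut k y i = .N := by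
  unfold colOut
  rw [if_neg (show ¬(i < k) by omega), if_neg (show ¬(i = k) by omega), if_pos (show i < k + y by omega)]

/-- The exit sides on piece `B1`. [cite: GlazmanManolescu2019, §1 (definition of the model)] -/
theorem colOut_B1 {i : ℕ} (hy : 1 ≤ y) (h1 : k + y ≤ i) (h2 : i ≤ k + y) : colOut k y i = .W := by
  unfold colOut
  rw [if_neg (show ¬(i < k) by omega), if_neg (show ¬(i = k) by omega), if_neg (show ¬(i < k + y) by omega), if_pos (show i = k + y by omega)]

/-- The exit sides on piece `C0`. [cite: GlazmanManolescu2019, §1 (definition of the model)] -/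
theorem colOut_C0 {i : ℕ} (h1 : k + y < i) (h2 : i < 2 * k + y + 2) : colOut k y i = .W := by
  unfold colOut
  rw [if_neg (show ¬(i < k) by omega), if_neg (show ¬(i = k) by omega), if_neg (show ¬(i < k + y) by omega), if_neg (show ¬(i = k + y) by omega), if_pos (show i < 2 * k + y + 2 by omega)]

/-- The exit sides on piece `C1`. [cite: GlazmanManolescu2019, §1 (definition of the model)] -/
theorem colOut_C1 {i : ℕ} (h1 : 2 * k + y + 2 ≤ i) (h2 : i ≤ 2 * k + y + 2) : colOut k y i = .S := by
  unfold colOut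
  rw [if_neg (show ¬(i < k) by omega), if_neg (show ¬(i = k) by omega), if_neg (show ¬(i < k + y) by omega), if_neg (show ¬(i = k + y) by omega), if_neg (show ¬(i < 2 * k + y + 2) by omega), if_pos (show i = 2 * k + y + 2 by omega)]

/-- The exit sides on piece `D0`. [cite: GlazmanManolescu2019, §1 (definition of the model)] -/
theorem colOut_D0 {i : ℕ} (h1 : 2 * k + y + 2 < i) (h2 : i < 2 * k + 2 * y + 3) : colOut k y i = .S := by
  unfold colOut
  rw [if_neg (show ¬(i < k) by omega), if_neg (show ¬(i = k) by omega), if_neg (show ¬(i < k + y) by omega), if_neg (show ¬(i = k + y) by omega), if_neg (show ¬(i < 2 * k + y + 2) by omega), if_neg (show ¬(i = 2 * k + y + 2) by omega), if_pos (show i < 2 * k + 2 * y + 3 by omega)]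

/-- The exit sides on piece `D1`. [cite: GlazmanManolescu2019, §1 (definition of the model)] -/
theorem colOut_D1 {i : ℕ} (h1 : 2 * k + 2 * y + 3 ≤ i) (h2 : i ≤ 2 * k + 2 * y + 3) : colOut k y i = .E := by
  unfold colOut
  rw [if_neg (show ¬(i < k) by omega), if_neg (show ¬(i = k) by omega), if_neg (show ¬(i < k + y) by omega), if_neg (show ¬(i = k + y) by omega), if_neg (show ¬(i < 2 * k + y + 2) by omega), if_neg (show ¬(i = 2 * k + y + 2) by omega), if_neg (show ¬(i < 2 * k + 2 * y + 3) by omega), if_pos (show i = 2 * k + 2 * y + 3 by omega)]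

/-- The exit sides on piece `E0`. [cite: GlazmanManolescu2019, §1 (definition of the model)] -/
theorem colOut_E0 {i : ℕ} (h1 : 2 * k + 2 * y + 3 < i) (h2 : i < 3 * k + 2 * y + 7) : colOut k y i = .E := by
  unfold colOut
  rw [if_neg (show ¬(i < k) by omega), if_neg (show ¬(i = k) by omega), if_neg (show ¬(i < k + y) by omega), if_neg (show ¬(i = k + y) by omega), if_neg (show ¬(i < 2 * k + y + 2) by omega), if_neg (show ¬(i = 2 * k + y + 2) by omega), if_neg (show ¬(i < 2 * k + 2 * y + 3) by omega), if_neg (show ¬(i = 2 * k + 2 * y + 3) by omega), if_pos (show i < 3 * k + 2 * y + 7 by omega)]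

/-- The exit sides on piece `E1`. [cite: GlazmanManolescu2019, §1 (definition of the model)] -/
theorem colOut_E1 {i : ℕ} (h1 : 3 * k + 2 * y + 7 ≤ i) (h2 : i ≤ 3 * k + 2 * y + 7) : colOut k y i = .N := by
  unfold colOut
  rw [if_neg (show ¬(i < k) by omega), if_neg (show ¬(i = k) by omega), if_neg (show ¬(i < k + y) by omega), if_neg (show ¬(i = k + y) by omega), if_neg (show ¬(i < 2 * k + y + 2) by omega), if_neg (show ¬(i = 2 * k + y + 2) by omega), if_neg (show ¬(i < 2 * k + 2 * y + 3) by omega), if_neg (show ¬(i = 2 * k + 2 * y + 3) by omega), if_neg (show ¬(i < 3 * k + 2 * y + 7) by omega), if_pos (show i = 3 * k + 2 * y + 7 by omega)]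

/-- The exit sides on piece `F0`. [cite: GlazmanManolescu2019, §1 (definition of the model)] -/
theorem colOut_F0 {i : ℕ} (h1 : 3 * k + 2 * y + 7 < i) (h2 : i < 3 * k + 3 * y + 8) : colOut k y i = .N := by
  unfold colOut
  rw [if_neg (show ¬(i < k) by omega), if_neg (show ¬(i = k) by omega), if_neg (show ¬(i < k + y) by omega), if_neg (show ¬(i = k + y) by omega), if_neg (show ¬(i < 2 * k + y + 2) by omega), if_neg (show ¬(i = 2 * k + y + 2) by omega), if_neg (show ¬(i < 2 * k + 2 * y + 3) by omega), if_neg (show ¬(i = 2 * k + 2 * y + 3) by omega), if_neg (show ¬(i < 3 * k + 2 * y + 7) by omega), if_neg (show ¬(i = 3 * k + 2 * y + 7) by omega), if_pos (show i < 3 * k + 3 * y + 8 by omega)]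

/-- The exit sides on piece `F1`. [cite: GlazmanManolescu2019, §1 (definition of the model)] -/
theorem colOut_F1 {i : ℕ} (h1 : 3 * k + 3 * y + 8 ≤ i) (h2 : i ≤ 3 * k + 3 * y + 8) : colOut k y i = .W := by
  unfold colOut
  rw [if_neg (show ¬(i < k) by omega), if_neg (show ¬(i = k) by omega), if_neg (show ¬(i < k + y) by omega), if_neg (show ¬(i = k + y) by omega), if_neg (show ¬(i < 2 * k + y + 2) by omega), if_neg (show ¬(i = 2 * k + y + 2) by omega), if_neg (show ¬(i < 2 * k + 2 * y + 3) by omega), if_neg (show ¬(i = 2 * k + 2 * y + 3) by omega), if_neg (show ¬(i < 3 * k + 2 * y + 7) by omega), if_neg (show ¬(i = 3 * k + 2 * y + 7) by omega), if_neg (show ¬(i < 3 * k + 3 * y + 8) by omega)]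

/-- The exit sides on piece `G0`. [cite: GlazmanManolescu2019, §1 (definition of the model)] -/
theorem colOut_G0 {i : ℕ} (h1 : 3 * k + 3 * y + 8 < i) : colOut k y i = .W := by
  unfold colOut
  rw [if_neg (show ¬(i < k) by omega), if_neg (show ¬(i = k) by omega), if_neg (show ¬(i < k + y) by omega), if_neg (show ¬(i = k + y) by omega), if_neg (show ¬(i < 2 * k + y + 2) by omega), if_neg (show ¬(i = 2 * k + y + 2) by omega), if_neg (show ¬(i < 2 * k + 2 * y + 3) by omega), if_neg (show ¬(i = 2 * k + 2 * y + 3) by omega), if_neg (show ¬(i < 3 * k + 2 * y + 7) by omega), if_neg (show ¬(i = 3 * k + 2 * y + 7) by omega), if_neg (show ¬(i < 3 * k + 3 * y + 8) by omega)]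

/-- Every index lies on one of the thirteen runs and corners. [cite: GlazmanManolescu2019, §1 (definition of the model)] -/
theorem colPieces {i : ℕ} (hi : i < 3 * k + 3 * y + 10) :
    i < k ∨ i = k ∨ (k < i ∧ i < k + y) ∨ i = k + y ∨ (k + y < i ∧ i < 2 * k + y + 2) ∨ i = 2 * k + y + 2 ∨
      (2 * k + y + 2 < i ∧ i < 2 * k + 2 * y + 3) ∨ i = 2 * k + 2 * y + 3 ∨ (2 * k + 2 * y + 3 < i ∧ i < 3 * k + 2 * y + 7) ∨
      i = 3 * k + 2 * y + 7 ∨ (3 * k + 2 * y + 7 < i ∧ i < 3 * k + 3 * y + 8) ∨ i = 3 * k + 3 * y + 8 ∨ i = 3 * k + 3 * y + 9 := by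
  omega

/-- Every index lies on one of the seven runs (corner included). [cite: GlazmanManolescu2019, §1 (definition of the model)] -/
theorem colPieces7 (i : ℕ) :
    i ≤ k ∨ (k < i ∧ i ≤ k + y) ∨ (k + y < i ∧ i ≤ 2 * k + y + 2) ∨ (2 * k + y + 2 < i ∧ i ≤ 2 * k + 2 * y + 3) ∨
      (2 * k + 2 * y + 3 < i ∧ i ≤ 3 * k + 2 * y + 7) ∨ (3 * k + 2 * y + 7 < i ∧ i ≤ 3 * k + 3 * y + 8) ∨ 3 * k + 3 * y + 8 < i := by
  omega

/-! ### The obligations of the face-path constructor -/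

/-- The faces are pairwise distinct. [cite: GlazmanManolescu2019, §1, Fig. 1] -/
theorem colFace_injective (hy : 1 ≤ y) : ∀ i j, i < 3 * k + 3 * y + 10 → j < 3 * k + 3 * y + 10 → colFace k y i = colFace k y j → i = j := by
  intro i j hi hj h
  rcases colPieces7 (k := k) (y := y) i with hi' | ⟨hi1, hi2⟩ | ⟨hi1, hi2⟩ | ⟨hi1, hi2⟩ | ⟨hi1, hi2⟩ | ⟨hi1, hi2⟩ | hi1 <;>
  [rw [colFace_A hi'] at h; rw [colFace_B hi1 hi2] at h; rw [colFace_C hi1 hi2] at h; rw [colFace_D hi1 hi2] at h;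
    rw [colFace_E hi1 hi2] at h; rw [colFace_F hi1 hi2] at h; rw [colFace_G hi1] at h] <;>
  rcases colPieces7 (k := k) (y := y) j with hj' | ⟨hj1, hj2⟩ | ⟨hj1, hj2⟩ | ⟨hj1, hj2⟩ | ⟨hj1, hj2⟩ | ⟨hj1, hj2⟩ | hj1 <;>
  [rw [colFace_A hj'] at h; rw [colFace_B hj1 hj2] at h; rw [colFace_C hj1 hj2] at h; rw [colFace_D hj1 hj2] at h;
    rw [colFace_E hj1 hj2] at h; rw [colFace_F hj1 hj2] at h; rw [colFace_G hj1] at h;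
   rw [colFace_A hj'] at h; rw [colFace_B hj1 hj2] at h; rw [colFace_C hj1 hj2] at h; rw [colFace_D hj1 hj2] at h;
    rw [colFace_E hj1 hj2] at h; rw [colFace_F hj1 hj2] at h; rw [colFace_G hj1] at h;
   rw [colFace_A hj'] at h; rw [colFace_B hj1 hj2] at h; rw [colFace_C hj1 hj2] at h; rw [colFace_D hj1 hj2] at h;
    rw [colFace_E hj1 hj2] at h; rw [colFace_F hj1 hj2] at h; rw [colFace_G hj1] at h;
   rw [colFace_A hj'] at h; rw [colFace_B hj1 hj2] at h; rw [colFace_C hj1 hj2] at h; rw [colFace_D hj1 hj2] at h;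
    rw [colFace_E hj1 hj2] at h; rw [colFace_F hj1 hj2] at h; rw [colFace_G hj1] at h;
   rw [colFace_A hj'] at h; rw [colFace_B hj1 hj2] at h; rw [colFace_C hj1 hj2] at h; rw [colFace_D hj1 hj2] at h;
    rw [colFace_E hj1 hj2] at h; rw [colFace_F hj1 hj2] at h; rw [colFace_G hj1] at h;
   rw [colFace_A hj'] at h; rw [colFace_B hj1 hj2] at h; rw [colFace_C hj1 hj2] at h; rw [colFace_D hj1 hj2] at h;
    rw [colFace_E hj1 hj2] at h; rw [colFace_F hj1 hj2] at h; rw [colFace_G hj1] at h;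
   rw [colFace_A hj'] at h; rw [colFace_B hj1 hj2] at h; rw [colFace_C hj1 hj2] at h; rw [colFace_D hj1 hj2] at h;
    rw [colFace_E hj1 hj2] at h; rw [colFace_F hj1 hj2] at h; rw [colFace_G hj1] at h] <;>
  (simp only [Prod.mk.injEq] at h; omega)

/-- Entry and exit sides differ. [cite: GlazmanManolescu2019, §1 (definition of the model)] -/
theorem colIn_ne_colOut (hy : 1 ≤ y) : ∀ i < 3 * k + 3 * y + 10, colIn k y i ≠ colOut k y i := by
  intro i hi
  rcases colPieces hi with h | h | ⟨h1, h2⟩ | h | ⟨h1, h2⟩ | h | ⟨h1, h2⟩ | h | ⟨h1, h2⟩ | h | ⟨h1, h2⟩ | h | h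
  · rw [colIn_A h.le, colOut_A0 h]; decide
  · rw [colIn_A h.le, colOut_A1 h.ge h.le]; decide
  · rw [colIn_B h1 h2.le, colOut_B0 h1 h2]; decide
  · rw [colIn_B (by omega) h.le, colOut_B1 hy h.ge h.le]; decide
  · rw [colIn_C h1 h2.le, colOut_C0 h1 h2]; decide
  · rw [colIn_C (by omega) h.le, colOut_C1 h.ge h.le]; decide
  · rw [colIn_D h1 h2.le, colOut_D0 h1 h2]; decide
  · rw [colIn_D (by omega) h.le, colOut_D1 h.ge h.le]; decide
  · rw [colIn_E h1 h2.le, colOut_E0 h1 h2]; decide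
  · rw [colIn_E (by omega) h.le, colOut_E1 h.ge h.le]; decide
  · rw [colIn_F h1 h2.le, colOut_F0 h1 h2]; decide
  · rw [colIn_F (by omega) h.le, colOut_F1 h.ge h.le]; decide
  · rw [colIn_G (k := k) (y := y) (i := i) (by omega), colOut_G0 (k := k) (y := y) (i := i) (by omega)]; decide

/-- Consecutive faces are glued along the crossed mid-edge. [cite: GlazmanManolescu2019, §1 (definition of the model)] -/
theorem colFace_glue (hy : 1 ≤ y) : ∀ i, i + 1 < 3 * k + 3 * y + 10 →
    (colFace k y i).side (colOut k y i) = (colFace k y (i + 1)).side (colIn k y (i + 1)) := by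
  intro i hi
  rcases colPieces (show i < 3 * k + 3 * y + 10 by omega) with h | h | ⟨h1, h2⟩ | h | ⟨h1, h2⟩ | h | ⟨h1, h2⟩ | h | ⟨h1, h2⟩ | h | ⟨h1, h2⟩ | h | h
  · rw [colFace_A h.le, colOut_A0 h, colFace_A (k := k) (y := y) (i := i + 1) (by omega), colIn_A (k := k) (y := y) (i := i + 1) (by omega)]
    simp only [Face.side, MidEdge.vert.injEq, and_true]; omega
  · rw [colFace_A h.le, colOut_A1 h.ge h.le, colFace_B (k := k) (y := y) (i := i + 1) (by omega) (by omega), colIn_B (k := k) (y := y) (i := i + 1) (by omega) (by omega)]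
    simp only [Face.side, MidEdge.slant.injEq]; omega
  · rw [colFace_B h1 h2.le, colOut_B0 h1 h2, colFace_B (k := k) (y := y) (i := i + 1) (by omega) (by omega), colIn_B (k := k) (y := y) (i := i + 1) (by omega) (by omega)]
    simp only [Face.side, MidEdge.slant.injEq, true_and]; omega
  · rw [colFace_B (by omega) h.le, colOut_B1 hy h.ge h.le, colFace_C (k := k) (y := y) (i := i + 1) (by omega) (by omega), colIn_C (k := k) (y := y) (i := i + 1) (by omega) (by omega)]
    simp only [Face.side, MidEdge.vert.injEq]; omega
  · rw [colFace_C h1 h2.le, colOut_C0 h1 h2, colFace_C (k := k) (y := y) (i := i + 1) (by omega) (by omega), colIn_C (k := k) (y := y) (i := i + 1) (by omega) (by omega)]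
    simp only [Face.side, MidEdge.vert.injEq, and_true]; omega
  · rw [colFace_C (by omega) h.le, colOut_C1 h.ge h.le, colFace_D (k := k) (y := y) (i := i + 1) (by omega) (by omega), colIn_D (k := k) (y := y) (i := i + 1) (by omega) (by omega)]
    simp only [Face.side, MidEdge.slant.injEq]; omega
  · rw [colFace_D h1 h2.le, colOut_D0 h1 h2, colFace_D (k := k) (y := y) (i := i + 1) (by omega) (by omega), colIn_D (k := k) (y := y) (i := i + 1) (by omega) (by omega)]
    simp only [Face.side, MidEdge.slant.injEq, true_and]; omega
  · rw [colFace_D (by omega) h.le, colOut_D1 h.ge h.le, colFace_E (k := k) (y := y) (i := i + 1) (by omega) (by omega), colIn_E (k := k) (y := y) (i := i + 1) (by omega) (by omega)]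
    simp only [Face.side, MidEdge.vert.injEq]; omega
  · rw [colFace_E h1 h2.le, colOut_E0 h1 h2, colFace_E (k := k) (y := y) (i := i + 1) (by omega) (by omega), colIn_E (k := k) (y := y) (i := i + 1) (by omega) (by omega)]
    simp only [Face.side, MidEdge.vert.injEq, and_true]; omega
  · rw [colFace_E (by omega) h.le, colOut_E1 h.ge h.le, colFace_F (k := k) (y := y) (i := i + 1) (by omega) (by omega), colIn_F (k := k) (y := y) (i := i + 1) (by omega) (by omega)]
    simp only [Face.side, MidEdge.slant.injEq]; omega
  · rw [colFace_F h1 h2.le, colOut_F0 h1 h2, colFace_F (k := k) (y := y) (i := i + 1) (by omega) (by omega), colIn_F (k := k) (y := y) (i := i + 1) (by omega) (by omega)]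
    simp only [Face.side, MidEdge.slant.injEq, true_and]; omega
  · rw [colFace_F (by omega) h.le, colOut_F1 h.ge h.le, colFace_G (k := k) (y := y) (i := i + 1) (by omega), colIn_G (k := k) (y := y) (i := i + 1) (by omega)]
    simp only [Face.side, MidEdge.vert.injEq]; omega
  · exfalso; omega

/-- No exit mid-edge is the root mid-edge `(4,2).side W`. [cite: GlazmanManolescu2019, §1 (the lattice of rhombi and its mid-edges)] -/
theorem colExit_ne_root (hy : 1 ≤ y) : ∀ j < 3 * k + 3 * y + 10, (colFace k y j).side (colOut k y j) ≠ (colFace k y 0).side (colIn k y 0) := by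
  intro i hi
  rw [colFace_A (Nat.zero_le _), colIn_A (Nat.zero_le _)]
  rcases colPieces hi with h | h | ⟨h1, h2⟩ | h | ⟨h1, h2⟩ | h | ⟨h1, h2⟩ | h | ⟨h1, h2⟩ | h | ⟨h1, h2⟩ | h | h
  · rw [colFace_A h.le, colOut_A0 h]; simp only [Face.side, ne_eq, MidEdge.vert.injEq]; omega
  · rw [colFace_A h.le, colOut_A1 h.ge h.le]; simp [Face.side]
  · rw [colFace_B h1 h2.le, colOut_B0 h1 h2]; simp [Face.side]
  · rw [colFace_B (by omega) h.le, colOut_B1 hy h.ge h.le]; simp only [Face.side, ne_eq, MidEdge.vert.injEq]; omega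
  · rw [colFace_C h1 h2.le, colOut_C0 h1 h2]; simp only [Face.side, ne_eq, MidEdge.vert.injEq]; omega
  · rw [colFace_C (by omega) h.le, colOut_C1 h.ge h.le]; simp [Face.side]
  · rw [colFace_D h1 h2.le, colOut_D0 h1 h2]; simp [Face.side]
  · rw [colFace_D (by omega) h.le, colOut_D1 h.ge h.le]; simp only [Face.side, ne_eq, MidEdge.vert.injEq]; omega
  · rw [colFace_E h1 h2.le, colOut_E0 h1 h2]; simp only [Face.side, ne_eq, MidEdge.vert.injEq]; omega
  · rw [colFace_E (by omega) h.le, colOut_E1 h.ge h.le]; simp [Face.side]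
  · rw [colFace_F h1 h2.le, colOut_F0 h1 h2]; simp [Face.side]
  · rw [colFace_F (by omega) h.le, colOut_F1 h.ge h.le]; simp only [Face.side, ne_eq, MidEdge.vert.injEq]; omega
  · rw [colFace_G (k := k) (y := y) (i := i) (by omega), colOut_G0 (k := k) (y := y) (i := i) (by omega)]; simp only [Face.side, ne_eq, MidEdge.vert.injEq]; omega

/-- The faces lie in the frame. [cite: GlazmanManolescu2019, §2.1 (finite domains of faces)] -/
theorem colFace_mem : ∀ i < 3 * k + 3 * y + 10, colFace k y i ∈ dom (colFrame42 k y) := fun i hi =>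
  List.mem_map.2 ⟨i, List.mem_range.2 hi, rfl⟩


/-- The face path starts at the root mid-edge `(4,2).side W`. [cite: GlazmanManolescu2019, §1 (definition of the model)] -/
theorem colPath_start : YBWalk.pathMid (colFace k y) (colIn k y) (colOut k y) 0 = w42.side .W := by
  rw [YBWalk.pathMid_zero, colFace_A (Nat.zero_le _), colIn_A (Nat.zero_le _)]; simp [Face.side, w42]

/-- The face path ends on the `E` side of `r = (4+k, 2+y)`. [cite: GlazmanManolescu2019, §1 (definition of the model)] -/
theorem colPath_end : YBWalk.pathMid (colFace k y) (colIn k y) (colOut k y) (3 * k + 3 * y + 10) = Face.side (((4 : ℤ) + k, (2 : ℤ) + y) : Face) .E := by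
  rw [YBWalk.pathMid_succ, colFace_G (k := k) (y := y) (i := 3 * k + 3 * y + 9) (by omega),
    colOut_G0 (k := k) (y := y) (i := 3 * k + 3 * y + 9) (by omega)]
  simp only [Face.side, MidEdge.vert.injEq, and_true]; omega

/-- ★ **THE PARAMETRIC COLUMN WITNESS** `(k, y)`, `y ≥ 1`, as a walk of its frame from the root `(4,2).side W` to the `E` side of `r = (4+k, 2+y)`.
[cite: GlazmanManolescu2019, §1 (definition of the model), Fig. 1] -/
def colWalkP (k y : ℕ) (hy : 1 ≤ y) : YBWalk (dom (colFrame42 k y)) (w42.side .W) (Face.side (((4 : ℤ) + k, (2 : ℤ) + y) : Face) .E) :=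
  (YBWalk.ofFacePath (3 * k + 3 * y + 10) (colFace k y) (colIn k y) (colOut k y) (colIn_ne_colOut hy) (colFace_glue hy)
    (colFace_injective hy) colFace_mem (colExit_ne_root hy)).cast colPath_start colPath_end

/-- The labelled parametric column witness (returns to the `E` side). [cite: Glazman2015WeightedSAW, Lemma 3.1 (proof, pp. 6–7: the classes of walks through a rhombus)] -/
def ωCP (k y : ℕ) (hy : 1 ≤ y) : ΩG (dom (colFrame42 k y)) (w42.side .W) (((4 : ℤ) + k, (2 : ℤ) + y) : Face) := ⟨.E, colWalkP k y hy⟩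

/-! ## §2 Certificates of the parametric witness -/

/-- `nth` of the parametric witness. [cite: GlazmanManolescu2019, §1 (definition of the model)] -/
theorem colWalkP_nth (hy : 1 ≤ y) {i : ℕ} (hi : i ≤ 3 * k + 3 * y + 10) :
    (colWalkP k y hy).nth i = YBWalk.pathMid (colFace k y) (colIn k y) (colOut k y) i := by
  unfold colWalkP; rw [YBWalk.cast_nth, YBWalk.ofFacePath_nth _ _ _ _ _ hi]

/-- The parametric witness has `3k + 3y + 10` arcs. [cite: GlazmanManolescu2019, §1 (definition of the model)] -/
theorem colWalkP_length (hy : 1 ≤ y) : (colWalkP k y hy).arcs.length = 3 * k + 3 * y + 10 := by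
  unfold colWalkP; rw [YBWalk.cast_arcs, YBWalk.ofFacePath_length]

/-- Plaquettes and sides of the parametric witness. [cite: GlazmanManolescu2019, §1, Fig. 1 and Fig. 2] -/
theorem colWalkP_fc_sIn_sOut (hy : 1 ≤ y) {i : ℕ} (hi : i < 3 * k + 3 * y + 10) :
    (colWalkP k y hy).fc i = colFace k y i ∧ (colWalkP k y hy).sIn i = colIn k y i ∧ (colWalkP k y hy).sOut i = colOut k y i := by
  unfold colWalkP
  obtain ⟨e1, e2, e3⟩ := YBWalk.cast_fc_sIn_sOut (YBWalk.ofFacePath (3 * k + 3 * y + 10) (colFace k y) (colIn k y) (colOut k y)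
    (colIn_ne_colOut hy) (colFace_glue hy) (colFace_injective hy) colFace_mem (colExit_ne_root hy)) colPath_start colPath_end i
  rw [e1, e2, e3]
  exact YBWalk.ofFacePath_fc_sIn_sOut _ _ _ _ _ hi

/-- The turning arcs of the parametric witness are the six corners. [cite: GlazmanManolescu2019, §1, Fig. 1] -/
theorem colTurn_iff (hy : 1 ≤ y) {i : ℕ} (hi : i < 3 * k + 3 * y + 10) :
    arcKind (colIn k y i) (colOut k y i) ≠ .straight ↔
      (i = k ∨ i = k + y ∨ i = 2 * k + y + 2 ∨ i = 2 * k + 2 * y + 3 ∨ i = 3 * k + 2 * y + 7 ∨ i = 3 * k + 3 * y + 8) := by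
  rcases colPieces hi with h | h | ⟨h1, h2⟩ | h | ⟨h1, h2⟩ | h | ⟨h1, h2⟩ | h | ⟨h1, h2⟩ | h | ⟨h1, h2⟩ | h | h
  · rw [colIn_A h.le, colOut_A0 h]; exact iff_of_false (by decide) (by omega)
  · rw [colIn_A h.le, colOut_A1 h.ge h.le]; exact iff_of_true (by decide) (by omega)
  · rw [colIn_B h1 h2.le, colOut_B0 h1 h2]; exact iff_of_false (by decide) (by omega)
  · rw [colIn_B (by omega) h.le, colOut_B1 hy h.ge h.le]; exact iff_of_true (by decide) (by omega)
  · rw [colIn_C h1 h2.le, colOut_C0 h1 h2]; exact iff_of_false (by decide) (by omega)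
  · rw [colIn_C (by omega) h.le, colOut_C1 h.ge h.le]; exact iff_of_true (by decide) (by omega)
  · rw [colIn_D h1 h2.le, colOut_D0 h1 h2]; exact iff_of_false (by decide) (by omega)
  · rw [colIn_D (by omega) h.le, colOut_D1 h.ge h.le]; exact iff_of_true (by decide) (by omega)
  · rw [colIn_E h1 h2.le, colOut_E0 h1 h2]; exact iff_of_false (by decide) (by omega)
  · rw [colIn_E (by omega) h.le, colOut_E1 h.ge h.le]; exact iff_of_true (by decide) (by omega)
  · rw [colIn_F h1 h2.le, colOut_F0 h1 h2]; exact iff_of_false (by decide) (by omega)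
  · rw [colIn_F (by omega) h.le, colOut_F1 h.ge h.le]; exact iff_of_true (by decide) (by omega)
  · rw [colIn_G (k := k) (y := y) (i := i) (by omega), colOut_G0 (k := k) (y := y) (i := i) (by omega)]
    exact iff_of_false (by decide) (by omega)

/-- The six corners, as the filtered index set. [cite: GlazmanManolescu2019, §1, Fig. 1] -/
theorem colTurn_card (hy : 1 ≤ y) : ((Finset.range (3 * k + 3 * y + 10)).filter fun i => arcKind (colIn k y i) (colOut k y i) ≠ .straight).card = 6 := by
  have e : ((Finset.range (3 * k + 3 * y + 10)).filter fun i => arcKind (colIn k y i) (colOut k y i) ≠ .straight) =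
      {k, k + y, 2 * k + y + 2, 2 * k + 2 * y + 3, 3 * k + 2 * y + 7, 3 * k + 3 * y + 8} := by
    ext i
    simp only [Finset.mem_filter, Finset.mem_range, Finset.mem_insert, Finset.mem_singleton]
    constructor
    · rintro ⟨hi, h⟩; exact (colTurn_iff hy hi).1 h
    · intro h
      have hi : i < 3 * k + 3 * y + 10 := by omega
      exact ⟨hi, (colTurn_iff hy hi).2 h⟩
  rw [e, Finset.card_insert_of_notMem ?_, Finset.card_insert_of_notMem ?_, Finset.card_insert_of_notMem ?_,
    Finset.card_insert_of_notMem ?_, Finset.card_insert_of_notMem ?_, Finset.card_singleton]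
  all_goals simp only [Finset.mem_insert, Finset.mem_singleton]; omega

/-- ★ **LIMIT COST `7`** of the parametric witness (slot `E`): six turning arcs, no doubly visited plaquette. [cite: GlazmanManolescu2019, §1, eq. (1); Remark 2.2] -/
theorem cost_colWalkP (hy : 1 ≤ y) : cost (slotOfSide .E) (colWalkP k y hy).mids = 7 := by
  unfold colWalkP
  rw [YBWalk.cast_mids, YBWalk.cost_ofFacePath, YBWalk.countP_range_eq_card, colTurn_card hy]
  decide

/-- Which exit mid-edges lie on the eastern ray of the hole: only the `N` side of `(6+k, 1)`. [cite: CourantRobbins1958, Ch. V Appendix §2 (the even–odd rule: the ray)] -/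
theorem colRay_iff (hy : 1 ≤ y) {m : ℕ} (hm : m < 3 * k + 3 * y + 10) :
    eastRayB w42 ((colFace k y m).side (colOut k y m)) = true ↔ m = 3 * k + 2 * y + 7 := by
  rcases colPieces hm with h | h | ⟨h1, h2⟩ | h | ⟨h1, h2⟩ | h | ⟨h1, h2⟩ | h | ⟨h1, h2⟩ | h | ⟨h1, h2⟩ | h | h
  · rw [colFace_A h.le, colOut_A0 h]; simp only [Face.side, eastRayB, Bool.false_eq_true, false_iff]; omega
  · rw [colFace_A h.le, colOut_A1 h.ge h.le]; simp only [Face.side, eastRayB, w42, decide_eq_true_eq]; omega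
  · rw [colFace_B h1 h2.le, colOut_B0 h1 h2]; simp only [Face.side, eastRayB, w42, decide_eq_true_eq]; omega
  · rw [colFace_B (by omega) h.le, colOut_B1 hy h.ge h.le]; simp only [Face.side, eastRayB, Bool.false_eq_true, false_iff]; omega
  · rw [colFace_C h1 h2.le, colOut_C0 h1 h2]; simp only [Face.side, eastRayB, Bool.false_eq_true, false_iff]; omega
  · rw [colFace_C (by omega) h.le, colOut_C1 h.ge h.le]; simp only [Face.side, eastRayB, w42, decide_eq_true_eq]; omega
  · rw [colFace_D h1 h2.le, colOut_D0 h1 h2]; simp only [Face.side, eastRayB, w42, decide_eq_true_eq]; omega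
  · rw [colFace_D (by omega) h.le, colOut_D1 h.ge h.le]; simp only [Face.side, eastRayB, Bool.false_eq_true, false_iff]; omega
  · rw [colFace_E h1 h2.le, colOut_E0 h1 h2]; simp only [Face.side, eastRayB, Bool.false_eq_true, false_iff]; omega
  · rw [colFace_E (by omega) h.le, colOut_E1 h.ge h.le]; simp only [Face.side, eastRayB, w42, decide_eq_true_eq]; omega
  · rw [colFace_F h1 h2.le, colOut_F0 h1 h2]; simp only [Face.side, eastRayB, w42, decide_eq_true_eq]; omega
  · rw [colFace_F (by omega) h.le, colOut_F1 h.ge h.le]; simp only [Face.side, eastRayB, Bool.false_eq_true, false_iff]; omega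
  · rw [colFace_G (k := k) (y := y) (i := m) (by omega), colOut_G0 (k := k) (y := y) (i := m) (by omega)]
    simp only [Face.side, eastRayB, Bool.false_eq_true, false_iff]; omega

/-- ★ **FIRST HIT `k + y`**: the parametric witness first touches `r` with its `(k+y)`-th mid-edge, the `S` side of `r`. [cite: Glazman2015WeightedSAW, Lemma 3.1 (proof, pp. 6–7)] -/
theorem firstHitG_colWalkP (hy : 1 ≤ y) : (colWalkP k y hy).firstHitG = k + y := by
  refine YBWalk.firstHitG_eq_of_nth _ (by rw [colWalkP_length]; omega) (s := .S) ?_ fun i hi t => ?_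
  · rw [colWalkP_nth hy (by omega), YBWalk.pathMid_eq_side_in (colFace_glue hy) (by omega), colFace_B (by omega) le_rfl,
      colIn_B (by omega) le_rfl]
    simp only [Face.side, MidEdge.slant.injEq, true_and]; omega
  · rw [colWalkP_nth hy (by omega), YBWalk.pathMid_eq_side_in (colFace_glue hy) (by omega)]
    rcases Nat.lt_or_ge k i with hik | hik
    · rw [colFace_B hik (by omega), colIn_B hik (by omega)]
      cases t <;> simp only [Face.side, ne_eq, MidEdge.slant.injEq, reduceCtorEq, not_false_eq_true] <;> omega
    · rw [colFace_A hik, colIn_A hik]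
      cases t <;> simp only [Face.side, ne_eq, MidEdge.vert.injEq, reduceCtorEq, not_false_eq_true] <;> omega

/-- No later arc of the parametric witness lies in `r` (class `B2a`). [cite: Glazman2015WeightedSAW, Lemma 3.1 (proof, pp. 6–7)] -/
theorem colWalkP_fc_ne (hy : 1 ≤ y) {j : ℕ} (hj1 : k + y < j) (hj2 : j < 3 * k + 3 * y + 10) :
    (colWalkP k y hy).fc j ≠ (((4 : ℤ) + k, (2 : ℤ) + y) : Face) := by
  rw [(colWalkP_fc_sIn_sOut hy hj2).1]
  intro h
  have hr : colFace k y (k + y) = (((4 : ℤ) + k, (2 : ℤ) + y) : Face) := by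
    rw [colFace_B (k := k) (y := y) (i := k + y) (by omega) le_rfl]
    simp only [Prod.mk.injEq, true_and]; omega
  exact absurd (colFace_injective hy j (k + y) hj2 (by omega) (h.trans hr.symm)) (by omega)

/-- The first arc in `r` turns (`S → W`). [cite: Glazman2015WeightedSAW, Lemma 3.1 (proof, pp. 6–7)] -/
theorem colWalkP_turn (hy : 1 ≤ y) : arcKind ((colWalkP k y hy).sIn (k + y)) ((colWalkP k y hy).sOut (k + y)) ≠ .straight := by
  obtain ⟨-, e2, e3⟩ := colWalkP_fc_sIn_sOut (k := k) hy (i := k + y) (by omega)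
  rw [e2, e3, colIn_B (by omega) le_rfl, colOut_B1 hy le_rfl le_rfl]; decide

/-- ★ **ONE exit mid-edge on the eastern ray of the hole** (odd ray count ⇒ wound). [cite: CourantRobbins1958, Ch. V Appendix §2 (the even–odd rule)] -/
theorem colWalkP_ray_card (hy : 1 ≤ y) : ((Finset.range (2 * k + 2 * y + 10)).filter fun j =>
    eastRayB w42 ((colWalkP k y hy).nth (k + y + j + 1)) = true).card = 1 := by
  have e : ((Finset.range (2 * k + 2 * y + 10)).filter fun j => eastRayB w42 ((colWalkP k y hy).nth (k + y + j + 1)) = true) =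
      {2 * k + y + 7} := by
    ext j
    simp only [Finset.mem_filter, Finset.mem_range, Finset.mem_singleton]
    constructor
    · rintro ⟨hj, h⟩
      rw [colWalkP_nth hy (by omega), YBWalk.pathMid_succ, colRay_iff hy (by omega)] at h; omega
    · intro h
      refine ⟨by omega, ?_⟩
      rw [colWalkP_nth hy (by omega), YBWalk.pathMid_succ, colRay_iff hy (by omega)]; omega
  rw [e, Finset.card_singleton]

/-- ★★ **THE CERTIFICATES OF THE PARAMETRIC WITNESS**: first hit `k + y`, `3k + 3y + 10` arcs, no later arc in the rhombus, ONE eastern-ray crossing, turning first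
arc, limit cost `7`. [cite: Glazman2015WeightedSAW, Lemma 3.1 (proof, pp. 6–7)] [cite: CourantRobbins1958, Ch. V Appendix §2 (the even–odd rule)]
[cite: GlazmanManolescu2019, §1, eq. (1); Remark 2.2] -/
theorem ωCP_cert (hy : 1 ≤ y) : (ωCP k y hy).2.firstHitG = k + y ∧ (ωCP k y hy).2.arcs.length = 3 * k + 3 * y + 10 ∧
    (∀ j < 3 * k + 3 * y + 10, k + y < j → (ωCP k y hy).2.fc j ≠ (((4 : ℤ) + k, (2 : ℤ) + y) : Face)) ∧
    ((Finset.range (2 * k + 2 * y + 10)).filter fun j => eastRayB w42 ((ωCP k y hy).2.nth (k + y + j + 1)) = true).card = 1 ∧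
    arcKind ((ωCP k y hy).2.sIn (k + y)) ((ωCP k y hy).2.sOut (k + y)) ≠ .straight ∧ cost (slotOfSide (ωCP k y hy).1) (ωCP k y hy).2.mids = 7 :=
  ⟨firstHitG_colWalkP hy, colWalkP_length hy, fun _ hj2 hj1 => colWalkP_fc_ne hy hj1 hj2, colWalkP_ray_card hy, colWalkP_turn hy,
    cost_colWalkP hy⟩

end Reference

/-! ## §3 Every position: the quadrant law above and below the root row -/

section Translate

variable {Dl : List Face} {w : Face} {k y : ℕ}

/-- The frame of the column witness `(k, y)` at the root plaquette `w`: the translate of `colFrame42 k y` — the `3k + 3y + 10` faces of the path at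
`(w.1 + ·, w.2 + ·) − (4, 2)`. [cite: GlazmanManolescu2019, §2.1, §4.2 (translation invariance)] -/
def colFrame (w : Face) (k y : ℕ) : List Face := (colFrame42 k y).map (Face.shiftBy (refShift w))

/-- The parametric reference witness, placed in the back-translated list containing its frame: class `B2a`, odd eastern-ray count, turning first arc, limit
cost `7`, `E` end. [cite: Glazman2015WeightedSAW, Lemma 3.1 (proof, pp. 6–7)] [cite: CourantRobbins1958, Ch. V Appendix §2 (the even–odd rule)] -/
theorem refWitnessCP (hy : 1 ≤ y) (hB₀ : ∀ c ∈ colFrame42 k y, c ∈ Dl.map (Face.shiftBy (-refShift w))) :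
    ∃ (ω₀ : ΩG (dom (Dl.map (Face.shiftBy (-refShift w)))) (w42.side .W) (((4 : ℤ) + k, (2 : ℤ) + y) : Face)) (_ : ω₀.IsB2a),
      Odd ((Finset.range ω₀.Mv).filter fun j => eastRayB w42 (ω₀.2.nth (ω₀.2.firstHitG + j + 1)) = true).card ∧
      arcKind (ω₀.2.sIn ω₀.2.firstHitG) (ω₀.2.sOut ω₀.2.firstHitG) ≠ .straight ∧ cost (slotOfSide ω₀.1) ω₀.2.mids = 7 ∧ (ω₀.1 = .E ∨ ω₀.1 = .W) := by
  obtain ⟨hF, hn, hfc, hodd, hNS, hc⟩ := ωCP_cert (k := k) hy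
  let ω₀ : ΩG (dom (Dl.map (Face.shiftBy (-refShift w)))) (w42.side .W) (((4 : ℤ) + k, (2 : ℤ) + y) : Face) :=
    ⟨.E, (colWalkP k y hy).mapDomain fun c hc => hB₀ c hc⟩
  have hF' : ω₀.2.firstHitG = k + y := hF
  have hn' : ω₀.2.arcs.length = 3 * k + 3 * y + 10 := hn
  have h₀ : ω₀.IsB2a := by
    refine ΩG.isB2a_of_forall_fc_ne (by rw [hF', hn']; omega) fun j hj1 hj2 => ?_
    rw [hF'] at hj1; rw [hn'] at hj2
    exact hfc j hj2 hj1
  have hM : ω₀.Mv = 2 * k + 2 * y + 10 := by unfold ΩG.Mv; rw [hF', hn']; omega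
  refine ⟨ω₀, h₀, ?_, by rw [hF']; exact hNS, hc, Or.inl rfl⟩
  rw [hM, hF', show ((Finset.range (2 * k + 2 * y + 10)).filter fun j => eastRayB w42 (ω₀.2.nth (k + y + j + 1)) = true).card = 1 from hodd]
  exact odd_one

/-- ★★★★ **A WOUND COST-`7` MEMBER WITH A TURNING FIRST ARC AT EVERY RHOMBUS OF THE QUADRANT ABOVE, EVERY POSITION** (`k ≥ 0`, `y ≥ 1`): every face list containing
the frame `colFrame w k y` carries a class-`B2a` walk at `(w.1 + k, w.2 + y)` from the root `w.side W` that is WOUND (`A_J ≠ 0`), turns at its first arc in the rhombus,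
has limit cost `7` and a vertical end side. [cite: GlazmanManolescu2019, §4.2 (translation invariance), Lemma 2.1; §1 eq. (1)]
[cite: Glazman2015WeightedSAW, Lemma 3.1 (proof, pp. 6–7)] [cite: CourantRobbins1958, Ch. V Appendix §2 (the even–odd rule)] -/
theorem exists_wound_cost_seven_of_colFrame (hy : 1 ≤ y) (hB : ∀ c ∈ colFrame w k y, c ∈ Dl) (hr : RootedFace (dom Dl) (w.side .W) (w.1 + k, w.2 + y)) :
    ∃ (ω : ΩG (dom Dl) (w.side .W) (w.1 + k, w.2 + y)) (h : ω.IsB2a), ω.AJ hr h (toC (midPt (w.side .W))) ≠ 0 ∧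
      arcKind (ω.2.sIn ω.2.firstHitG) (ω.2.sOut ω.2.firstHitG) ≠ .straight ∧ cost (slotOfSide ω.1) ω.2.mids = 7 ∧ (ω.1 = .E ∨ ω.1 = .W) := by
  have hB₀ := block42_mem_of_block_mem (B := colFrame42 k y) hB
  have hrr : Face.shiftBy (refShift w) ((((4 : ℤ) + k, (2 : ℤ) + y)) : Face) = (w.1 + k, w.2 + y) := shiftBy_refShift_col w k y
  obtain ⟨ω₀, h₀, hodd, hNS, hc, hv⟩ := refWitnessCP hy hB₀
  exact ΩG.exists_wound_cost_seven_turn_shift (shiftBy_refShift_root w) hrr hr (rootedFace_refShift_back' (shiftBy_refShift_root w) hrr hr) ω₀ h₀ hodd hNS hc hv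

/-- ★★★★ **THE HYPOTHESIS `hex` OF THE COLUMN LAW ABOVE, DISCHARGED AT EVERY CELL** (`k ≥ 0`, `y ≥ 1`). [cite: GlazmanManolescu2019, Lemma 2.1 (proof: the groups of three
walks); §1 eq. (1); §4.2] [cite: Glazman2015WeightedSAW, Lemma 3.1 (proof, pp. 6–7)] [cite: CourantRobbins1958, Ch. V Appendix §2 (the even–odd rule)] -/
theorem exists_wound_ext₃_cost_five_of_colFrame (hy : 1 ≤ y) (hB : ∀ c ∈ colFrame w k y, c ∈ Dl) (hr : RootedFace (dom Dl) (w.side .W) (w.1 + k, w.2 + y)) :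
    ∃ (ω : ΩG (dom Dl) (w.side .W) (w.1 + k, w.2 + y)) (h : ω.IsB2a), ω.AJ hr h (toC (midPt (w.side .W))) ≠ 0 ∧
      arcKind (ω.2.sIn ω.2.firstHitG) (ω.2.sOut ω.2.firstHitG) ≠ .straight ∧ cost (slotOfSide (ω.ext₃ hr).1) (ω.ext₃ hr).2.mids = 5 := by
  obtain ⟨ω, h, hA, hNS, hc, hv⟩ := exists_wound_cost_seven_of_colFrame hy hB hr
  exact ⟨ω, h, hA, hNS, (ΩG.cost_ext₃_eq_five_iff hr h hNS).2 (Or.inr ⟨hc, hv⟩)⟩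

/-- ★★★★★ **THE QUADRANT LAW ABOVE THE ROOT ROW.** For EVERY `k ≥ 0`, `y ≥ 1` and every finite face list `Dl` missing the hole `(w.1 − 1, w.2)` and containing the
frame `colFrame w k y`, the printed Yang–Baxter vertex functional at the root `w.side W` and the rhombus `(w.1 + k, w.2 + y)` has finitely many zeros in `(0, π)`,
at most `4·maxExp − 4`. [cite: GlazmanManolescu2019, Lemma 2.1 and eq. (1); Remark 2.2; §4.2] [cite: Glazman2015WeightedSAW, Lemma 3.1 (proof, pp. 6–7)] -/
theorem vertexFunctional_printed_zero_set_finite_of_colFrame (hy : 1 ≤ y) (hh : holeFaceW w ∉ dom Dl) (hB : ∀ c ∈ colFrame w k y, c ∈ Dl)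
    (hr : RootedFace (dom Dl) (w.side .W) (w.1 + k, w.2 + y)) :
    {θ ∈ Set.Ioo 0 π | vertexFunctional (printedWeights θ) tFiveEighths (ybCoeff θ) Dl (w.side .W) (w.1 + k, w.2 + y) = 0}.Finite ∧
      {θ ∈ Set.Ioo 0 π | vertexFunctional (printedWeights θ) tFiveEighths (ybCoeff θ) Dl (w.side .W) (w.1 + k, w.2 + y) = 0}.ncard ≤
        4 * maxExp Dl (w.side .W) (w.1 + k, w.2 + y) + 1 - 5 :=
  vertexFunctional_printed_zero_set_finite_above Dl hh hr (by simp only; omega) (by simp only; omega)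
    (exists_wound_ext₃_cost_five_of_colFrame hy hB hr)

/-- ★★★★★ **NOT IDENTICALLY ZERO AT EVERY CELL OF THE QUADRANT ABOVE**: under the same hypotheses some `θ ∈ (0, π)` has `VF_D(w.side W, (w.1 + k, w.2 + y); θ) ≠ 0`.
[cite: GlazmanManolescu2019, Lemma 2.1 and eq. (1); Remark 2.2; §4.2] [cite: Glazman2015WeightedSAW, Lemma 3.1 (proof, pp. 6–7)] -/
theorem vertexFunctional_printed_exists_ne_zero_of_colFrame (hy : 1 ≤ y) (hh : holeFaceW w ∉ dom Dl) (hB : ∀ c ∈ colFrame w k y, c ∈ Dl)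
    (hr : RootedFace (dom Dl) (w.side .W) (w.1 + k, w.2 + y)) :
    ∃ θ ∈ Set.Ioo 0 π, vertexFunctional (printedWeights θ) tFiveEighths (ybCoeff θ) Dl (w.side .W) (w.1 + k, w.2 + y) ≠ 0 :=
  vertexFunctional_printed_exists_ne_zero_above Dl hh hr (by simp only; omega) (by simp only; omega)
    (exists_wound_ext₃_cost_five_of_colFrame hy hB hr)

/-- ★★★★★ **THE QUADRANT LAW BELOW THE ROOT ROW** (row mirror): for EVERY `k ≥ 0`, `y ≥ 1` and every finite face list missing the hole and containing the reflected
frame `(colFrame w k y).map ρ`, the printed vertex functional at `(w.1 + k, w.2 − y)` has finitely many zeros in `(0, π)`, at most `4·maxExp(ρDl) − 4`.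
[cite: GlazmanManolescu2019, Lemma 2.1 and eq. (1); Remark 2.2; §4.2 (lattice symmetries)] [cite: Glazman2015WeightedSAW, Lemma 3.1 (proof, pp. 6–7)] -/
theorem vertexFunctional_printed_zero_set_finite_of_colFrame_below (hy : 1 ≤ y) (hh : holeFaceW w ∉ dom Dl)
    (hB : ∀ c ∈ (colFrame w k y).map (mirrorRowFace w.2), c ∈ Dl) (hr : RootedFace (dom Dl) (w.side .W) (w.1 + k, w.2 - y)) :
    {θ ∈ Set.Ioo 0 π | vertexFunctional (printedWeights θ) tFiveEighths (ybCoeff θ) Dl (w.side .W) (w.1 + k, w.2 - y) = 0}.Finite ∧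
      {θ ∈ Set.Ioo 0 π | vertexFunctional (printedWeights θ) tFiveEighths (ybCoeff θ) Dl (w.side .W) (w.1 + k, w.2 - y) = 0}.ncard ≤
        4 * maxExp (Dl.map (mirrorRowFace w.2)) (w.side .W) (w.1 + k, w.2 + y) + 1 - 5 := by
  have e := mirrorRowFace_below w k y
  have hr' := rootedFace_map_mirrorRowFace hr
  rw [e] at hr'
  have hB' : ∀ c ∈ colFrame w k y, c ∈ Dl.map (mirrorRowFace w.2) := fun c hc =>
    List.mem_map.2 ⟨mirrorRowFace w.2 c, hB _ (List.mem_map.2 ⟨c, hc, rfl⟩), mirrorRowFace_mirrorRowFace _ _⟩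
  have h := vertexFunctional_printed_zero_set_finite_of_colFrame hy (holeFaceW_not_mem_dom_map_mirrorRowFace hh) hB' hr'
  refine vertexFunctional_printed_zero_set_finite_of_mirrorRow ?_
  rw [e]; exact h

/-- ★★★★★ **NOT IDENTICALLY ZERO AT EVERY CELL OF THE QUADRANT BELOW**: under the same hypotheses some `θ ∈ (0, π)` has `VF_D(w.side W, (w.1 + k, w.2 − y); θ) ≠ 0`.
[cite: GlazmanManolescu2019, Lemma 2.1 and eq. (1); Remark 2.2; §4.2 (lattice symmetries)] [cite: Glazman2015WeightedSAW, Lemma 3.1 (proof, pp. 6–7)] -/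
theorem vertexFunctional_printed_exists_ne_zero_of_colFrame_below (hy : 1 ≤ y) (hh : holeFaceW w ∉ dom Dl)
    (hB : ∀ c ∈ (colFrame w k y).map (mirrorRowFace w.2), c ∈ Dl) (hr : RootedFace (dom Dl) (w.side .W) (w.1 + k, w.2 - y)) :
    ∃ θ ∈ Set.Ioo 0 π, vertexFunctional (printedWeights θ) tFiveEighths (ybCoeff θ) Dl (w.side .W) (w.1 + k, w.2 - y) ≠ 0 := by
  have e := mirrorRowFace_below w k y
  have hr' := rootedFace_map_mirrorRowFace hr
  rw [e] at hr'
  have hB' : ∀ c ∈ colFrame w k y, c ∈ Dl.map (mirrorRowFace w.2) := fun c hc =>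
    List.mem_map.2 ⟨mirrorRowFace w.2 c, hB _ (List.mem_map.2 ⟨c, hc, rfl⟩), mirrorRowFace_mirrorRowFace _ _⟩
  have h := vertexFunctional_printed_exists_ne_zero_of_colFrame hy (holeFaceW_not_mem_dom_map_mirrorRowFace hh) hB' hr'
  refine vertexFunctional_printed_exists_ne_zero_of_mirrorRow ?_
  rw [e]; exact h

end Translate


end Literature.Barriers.CriticalPhenomena.PlaquetteWalk
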